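import Summits.BirchSwinnertonDyer.BirchSwinnertonDyer.Theorems.AdditiveBranchIMCTwistRootNumberDyadicOfMultTwo
import Summits.BirchSwinnertonDyer.BirchSwinnertonDyer.Theorems.AdditiveBranchIMCGordTwoRankZeroOffCaseOneFieldSupplyTwoR0Aux
import Literature.NumberTheory.EllipticCurves.NonvanishingTwistsProofs
import Literature.NumberTheory.EllipticCurves.NonvanishingTwistsBumpFriedbergHoffstein
import Literature.NumberTheory.EllipticCurves.NonvanishingTwistsPrescribedSplitting
import HarnessLib

/-!
# SUPPLY₂ of door D (RANK ONE, for the pen's 19358 `wan_tame_bdp_road`): THE DYADIC TWISTED ROAD FIELD from Friedberg–Hoffstein's prescribed-splitting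
# non-vanishing instance (crux 19357/19358, door D «`ℓ₀ = 2`», LeadReport27 §5 item 4; LEAD cruxlead-19357 g18, `--supports` 19358, groundwork)
The r₁ twin of `fieldOneTwistedR0_two_of_bfh` (same session): for `E` (`w(E) = −1`, odd additive primes of twist type), `p ≠ 2`, a DYADIC twisted Wan prime
(`W₁ = E^{(t)}` multiplicative at `2`, `t ∈ {−1, 2, −2}`): arbitrarily large imaginary quadratic `K` with `d_K = 4t·n` in the dyadic genus class of p814401,
odd bad primes and `p` split, and `L(E^{(d_K)}, 1) ≠ 0`. Same road: `X = E^{(4t·a*)} ≅ W₁^{(a*)}` now has `w(X) = −1` AUTOMATICALLY (p817922, p817996), and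
`friedbergHoffstein_exists_heegnerField_splitDivisors_twist_ne_zero` (⟸ Hoffstein–Luo + modularity, tree) replaces BFH (i). Theorems only; BSD proved for no curve.
* `fieldOneTwisted_two_of_fh`. References: [FriedbergHoffstein1995] Thm. B; [HoffsteinLuo1997]; [SilvermanAEC2009] X.5 Cor. 5.4.
-/

set_option linter.dupNamespace false
set_option autoImplicit false

noncomputable section

open scoped Classical

open WeierstrassCurve IsDedekindDomain NumberField Rat.HeightOneSpectrum
  Literature.NumberTheory.EllipticCurves Literature.NumberTheory.EllipticCurves.ModularForms
  Literature.NumberTheory.EllipticCurves.Rank1Residual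
  Summit.BirchSwinnertonDyer.BirchSwinnertonDyer.Theorems

namespace Summit.BirchSwinnertonDyer.BirchSwinnertonDyer.Theorems.TwistedWanRoad

open NumberTheorySymbols

/-- `(a / b) = 1` forces `b ∤ a` (`b > 1`). [folklore] -/
private theorem not_dvd_of_jacobiSym_eq_one₃ {a : ℤ} {b : ℕ} (hb : 1 < b) (h : jacobiSym a b = 1) : ¬ (b : ℤ) ∣ a := by
  intro hdvd
  have h0 : jacobiSym a b = 0 := by
    rw [jacobiSym.mod_left, Int.emod_eq_zero_of_dvd hdvd, jacobiSym.zero_left hb]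
  rw [h0] at h
  exact zero_ne_one h

/-- The Jacobi symbol of `t ∈ {−1, 2, −2}` at an odd prime is `±1`. [folklore] -/
private theorem jacobiSym_dyadic_eq_one_or' {t : ℤ} (ht : t = -1 ∨ t = 2 ∨ t = -2) {r : ℕ} (hr : r.Prime) (hr2 : r ≠ 2) :
    J(t | r) = 1 ∨ J(t | r) = -1 := by
  refine jacobiSym.eq_one_or_neg_one ?_
  rw [Int.gcd_comm]
  have hodd : r % 2 = 1 := hr.eq_two_or_odd.resolve_left hr2
  rcases ht with rfl | rfl | rfl
  · simp [Int.gcd]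
  · rw [Int.gcd_eq_natAbs]; simp only [Int.reduceAbs, Int.natAbs_natCast]
    exact Nat.Coprime.symm ((Nat.Prime.coprime_iff_not_dvd hr).mpr fun h ↦ hr2 ((Nat.prime_dvd_prime_iff_eq hr Nat.prime_two).mp h)) |>.symm
  · rw [Int.gcd_eq_natAbs]; simp only [Int.reduceNeg, Int.reduceAbs, Int.natAbs_natCast]
    exact Nat.Coprime.symm ((Nat.Prime.coprime_iff_not_dvd hr).mpr fun h ↦ hr2 ((Nat.prime_dvd_prime_iff_eq hr Nat.prime_two).mp h)) |>.symm

/-- **SUPPLY₂ (rank one): the dyadic twisted road field from Friedberg–Hoffstein's prescribed-splitting instance** (module docstring).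
[cite: FriedbergHoffstein1995, Thm. B] [cite: JetchevSkinnerWan2017, §7.4.2 (p. 31)] [cite: SilvermanAEC2009, X.5 Cor. 5.4 and Ex. 10.16] -/
theorem fieldOneTwisted_two_of_fh (hFH : friedbergHoffstein_exists_heegnerField_splitDivisors_twist_ne_zero) :
    ∀ (W : WeierstrassCurve ℚ) [W.IsElliptic] [W.IsGloballyMinimal], exists_isNewformOf →
    (∀ r : Nat.Primes, (r : ℕ) ≠ 2 → W.HasAdditiveReductionAt ((primesEquiv (R := ℤ)).symm r) →
      ¬ (W.quadraticTwist (((-1 : ℤ) ^ ((r : ℕ) / 2) * r : ℤ) : ℚ)).HasAdditiveReductionAt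
        ((primesEquiv (R := ℤ)).symm r)) →
    W.rootNumber = -1 →
    ∀ (p : ℕ) (t : ℤ), p.Prime → p ≠ 2 → (t = -1 ∨ t = 2 ∨ t = -2) →
      (W.quadraticTwist (t : ℚ)).HasMultiplicativeReductionAtPrime 2 → ∀ B : ℕ,
      ∃ (K : Type) (_ : Field K) (_ : NumberField K),
        IsImaginaryQuadratic K ∧ NumberField.discr K < -4 ∧
        (∃ n : ℤ, NumberField.discr K = 4 * t * n ∧
          n % 8 = (if (W.quadraticTwist (t : ℚ)).HasSplitMultiplicativeReductionAtPrime 2 then 5 else 1)) ∧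
        (∀ r : ℕ, r.Prime → r ∣ W.conductorNorm ℤ → r ≠ 2 → ((Ideal.span {(r : ℤ)}).primesOver (𝓞 K)).ncard = 2) ∧
        SatisfiesHeegnerHypothesis p K ∧ B < (NumberField.discr K).natAbs ∧
        (W.quadraticTwist (NumberField.discr K : ℚ)).entireLFunction 1 ≠ 0 := by
  intro W _ _ hmod htt hw p t hp hp2 ht hm2t B
  haveI : Fact p.Prime := ⟨hp⟩
  have ht0 : t ≠ 0 := by rcases ht with rfl | rfl | rfl <;> norm_num
  have htQ : (t : ℚ) ≠ 0 := by exact_mod_cast ht0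
  have htodd : ∀ r : ℕ, r.Prime → r ≠ 2 → ¬ (r : ℤ) ∣ t := by
    intro r hr hr2 h
    have h' : (r : ℤ) ∣ 2 := by
      rcases ht with rfl | rfl | rfl
      · exact (dvd_neg.mp h).trans (one_dvd _)
      · exact h
      · exact dvd_neg.mp h
    exact hr2 ((Nat.prime_dvd_prime_iff_eq hr Nat.prime_two).mp (by exact_mod_cast h'))
  set N : ℕ := W.conductorNorm ℤ with hN
  have hN0 : N ≠ 0 := (W.conductorNorm_pos_holds).ne'
  obtain ⟨W₁, iW₁, iW₁m, C₁, hC₁⟩ := exists_isGloballyMinimal_smul_eq_quadraticTwist W htQ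
  haveI := W.isElliptic_quadraticTwist htQ
  have hm2 : W₁.HasMultiplicativeReductionAtPrime 2 := by
    rw [← hasMultiplicativeReductionAtPrime_smul_iff W₁ C₁ 2, hC₁]; exact hm2t
  have hsplit_iff : W₁.HasSplitMultiplicativeReductionAtPrime 2 ↔ (W.quadraticTwist (t : ℚ)).HasSplitMultiplicativeReductionAtPrime 2 := by
    rw [← hasSplitMultiplicativeReductionAtPrime_smul_iff W₁ C₁ 2, hC₁]
  set N₁ : ℕ := W₁.conductorNorm ℤ with hN₁
  have hN₁0 : N₁ ≠ 0 := (W₁.conductorNorm_pos_holds).ne'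
  have hN₁eq : N₁ = (W.quadraticTwist (t : ℚ)).conductorNorm ℤ := by rw [hN₁, ← hC₁, conductorNorm_smul_rat]
  have hfac_odd : ∀ r : ℕ, r.Prime → r ≠ 2 → N₁.factorization r = N.factorization r := by
    intro r hr hr2
    rw [hN₁eq]; exact ManinLocalTwoThree.factorization_conductorNorm_quadraticTwist_eq_of_not_dvd_odd W hr hr2 (htodd r hr hr2)
  have hdvd_fac : ∀ (n : ℕ) (hn : n ≠ 0) (r : ℕ), r.Prime → (r ∣ n ↔ n.factorization r ≠ 0) := fun n hn r hr ↦ by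
    rw [Ne, Nat.factorization_eq_zero_iff]; push Not; exact ⟨fun h ↦ ⟨hr, h, hn⟩, fun h ↦ h.2.1⟩
  have hodd_dvd : ∀ r : ℕ, r.Prime → r ≠ 2 → (r ∣ N₁ ↔ r ∣ N) := fun r hr hr2 ↦ by
    rw [hdvd_fac N₁ hN₁0 r hr, hdvd_fac N hN0 r hr, hfac_odd r hr hr2]
  have httW₁ : ∀ r : Nat.Primes, (r : ℕ) ≠ 2 → W₁.HasAdditiveReductionAt ((primesEquiv (R := ℤ)).symm r) →
      ¬ (W₁.quadraticTwist (((-1 : ℤ) ^ ((r : ℕ) / 2) * r : ℤ) : ℚ)).HasAdditiveReductionAt ((primesEquiv (R := ℤ)).symm r) := by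
    intro r hr2 haddW₁
    set v := (primesEquiv (R := ℤ)).symm r with hv
    have hv2 : natGenerator v ≠ 2 := by rw [hv, Rat.natGenerator_primesEquiv_symm]; exact hr2
    have hvt : ¬ ((natGenerator v : ℕ) : ℤ) ∣ t := by rw [hv, Rat.natGenerator_primesEquiv_symm]; exact htodd r r.2 hr2
    have haddWt : (W.quadraticTwist (t : ℚ)).HasAdditiveReductionAt v := by
      rw [← hC₁]; exact (hasAdditiveReductionAt_smul_iff_holds v W₁ C₁).mpr haddW₁
    have haddW : W.HasAdditiveReductionAt v := ((W.hasReductionAt_quadraticTwist_iff_of_not_dvd v hv2 hvt).2.2).mp haddWt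
    have hsemi := htt r hr2 haddW
    set s : ℤ := (-1 : ℤ) ^ ((r : ℕ) / 2) * r with hs
    have hs0 : ((s : ℤ) : ℚ) ≠ 0 := by
      have : s ≠ 0 := mul_ne_zero (pow_ne_zero _ (by norm_num)) (by exact_mod_cast r.2.ne_zero)
      exact_mod_cast this
    haveI := W.isElliptic_quadraticTwist hs0
    haveI := (W.quadraticTwist ((s : ℤ) : ℚ)).isElliptic_quadraticTwist htQ
    have hnot : ¬ ((W.quadraticTwist ((s : ℤ) : ℚ)).quadraticTwist (t : ℚ)).HasAdditiveReductionAt v :=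
      fun h ↦ hsemi ((((W.quadraticTwist ((s : ℤ) : ℚ)).hasReductionAt_quadraticTwist_iff_of_not_dvd v hv2 hvt).2.2).mp h)
    have heq : W₁.quadraticTwist ((s : ℤ) : ℚ) =
        (⟨C₁⁻¹.u, ((s : ℤ) : ℚ) * C₁⁻¹.r, 0, 0⟩ : VariableChange ℚ) • ((W.quadraticTwist ((s : ℤ) : ℚ)).quadraticTwist (t : ℚ)) := by
      have hW₁ : W₁ = C₁⁻¹ • W.quadraticTwist (t : ℚ) := by rw [← hC₁, inv_smul_smul]
      rw [hW₁, quadraticTwist_smul, quadraticTwist_quadraticTwist, quadraticTwist_quadraticTwist, mul_comm (t : ℚ)]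
    rw [heq]
    exact fun h ↦ hnot ((hasAdditiveReductionAt_smul_iff_holds v _ _).mp h)
  have hwW₁t : (W₁.quadraticTwist (t : ℚ)).rootNumber = -1 := by
    obtain ⟨C₂, hC₂⟩ := W.exists_variableChange_smul_eq_quadraticTwist_sq (θ := (t : ℚ)) htQ
    have hW₁ : W₁ = C₁⁻¹ • W.quadraticTwist (t : ℚ) := by rw [← hC₁, inv_smul_smul]
    have heq : W₁.quadraticTwist (t : ℚ) =
        ((⟨C₁⁻¹.u, (t : ℚ) * C₁⁻¹.r, 0, 0⟩ : VariableChange ℚ) * C₂) • W := by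
      rw [hW₁, quadraticTwist_smul, quadraticTwist_quadraticTwist, mul_smul, hC₂, sq]
    rw [heq, rootNumber_smul_holds]; exact hw
  -- §1 the genus class, the sign and the Dirichlet prime `a`
  set c8 : ℤ := (if W₁.HasSplitMultiplicativeReductionAtPrime 2 then 5 else 1) with hc8
  have hc8' : c8 = 1 ∨ c8 = 5 := by by_cases h : W₁.HasSplitMultiplicativeReductionAtPrime 2 <;> simp [hc8, h]
  have hc84 : c8 % 4 = 1 := by rcases hc8' with h | h <;> rw [h] <;> decide
  set σ : ℤ := (if t = 2 then 1 else -1) with hσdef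
  have hσ : σ = 1 ∨ σ = -1 := by by_cases h : t = 2 <;> simp [hσdef, h]
  set S : Finset ℕ := insert p (N.primeFactors.erase 2) with hSdef
  have hSodd : ∀ r ∈ S, r.Prime ∧ r ≠ 2 := by
    intro r hr
    rw [hSdef, Finset.mem_insert] at hr
    rcases hr with rfl | hr
    · exact ⟨hp, hp2⟩
    · obtain ⟨hr2, hr⟩ := Finset.mem_erase.mp hr
      exact ⟨(Nat.mem_primeFactors.mp hr).1, hr2⟩
  set η : ℕ → ℤ := fun r ↦ J(t | r) with hη
  have hηpm : ∀ r ∈ S, η r = 1 ∨ η r = -1 := fun r hr ↦ jacobiSym_dyadic_eq_one_or' ht (hSodd r hr).1 (hSodd r hr).2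
  obtain ⟨a, ha, haB, hσa, h8, hJ⟩ := WanAnyRoad.exists_prime_star_prescribed_of_emod_four hc84 hσ S hSodd η hηpm (N + p + 2)
  haveI haF : Fact a.Prime := ⟨ha⟩
  set as : ℤ := (-1 : ℤ) ^ (a / 2) * a with has
  obtain ⟨hap, ha2⟩ : a ≠ p ∧ a ≠ 2 := ⟨by omega, by omega⟩
  have haN : ¬ a ∣ N := fun h ↦ by have := Nat.le_of_dvd (Nat.pos_of_ne_zero hN0) h; omega
  have haN₁ : ¬ a ∣ N₁ := fun h ↦ haN ((hodd_dvd a ha ha2).mp h)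
  have has_eq : as = σ * a := by rw [has, hσa]
  have has4 : as % 4 = 1 := by rw [has]; exact TwistRootNumberAnyTwo.pStar_emod_four ⟨a, ha⟩ ha2
  have has8 : as % 8 = c8 := by
    have e : (c8 * as) % 8 = 1 := by rw [has]; exact h8
    rcases hc8' with h | h <;> rw [h] at e ⊢ <;> omega
  have has0 : as ≠ 0 := by rw [has]; exact mul_ne_zero (pow_ne_zero _ (by norm_num)) (by exact_mod_cast ha.ne_zero)
  have hasabs : as.natAbs = a := by
    rw [has, Int.natAbs_mul, Int.natAbs_pow, Int.natAbs_neg, Int.natAbs_one, one_pow, one_mul, Int.natAbs_natCast]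
  have hassq : Squarefree as := Int.squarefree_natAbs.mp (by rw [hasabs]; exact ha.prime.squarefree)
  have hJp : J(as | p) = J(t | p) := by
    have h := hJ p (by rw [hSdef]; exact Finset.mem_insert_self _ _); simpa only [hη] using h
  have hJbad : ∀ r : ℕ, r.Prime → r ∣ N → r ≠ 2 → J(as | r) = J(t | r) := by
    intro r hr hrN hr2
    have h := hJ r (by rw [hSdef]; exact Finset.mem_insert_of_mem (Finset.mem_erase.mpr ⟨hr2, Nat.mem_primeFactors.mpr ⟨hr, hrN, hN0⟩⟩))
    simpa only [hη] using h
  have hJtsq : ∀ r : ℕ, r.Prime → r ≠ 2 → J(t | r) * J(t | r) = 1 := by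
    intro r hr hr2
    rcases jacobiSym_dyadic_eq_one_or' ht hr hr2 with h | h <;> rw [h] <;> norm_num
  -- §2 the auxiliary twist `X = E^{(4t·a*)} ≅ W₁^{(a*)}` has root number `+1`
  have hgood_as : ∀ r : Nat.Primes, ((r : ℕ) : ℤ) ∣ as → W₁.HasGoodReductionAt ((primesEquiv (R := ℤ)).symm r) := by
    intro r hr
    have h' : (r : ℕ) ∣ as.natAbs := Int.natCast_dvd.mp hr
    rw [hasabs] at h'
    have hra : (r : ℕ) = a := (Nat.prime_dvd_prime_iff_eq r.2 ha).mp h'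
    have : r = ⟨a, ha⟩ := Subtype.ext hra
    subst this
    have hgood : W₁.HasGoodReductionAtPrime a := by
      by_contra h; exact haN₁ ((W₁.dvd_conductorNorm_iff_not_hasGoodReductionAtPrime a).mpr h)
    exact (W₁.hasGoodReductionAtPrime_iff_hasGoodReductionAt_holds ⟨a, ha⟩).mp hgood
  have hengine₂ := TwistRootNumberTwisted.rootNumber_quadraticTwist_dyadic_of_hasMultiplicativeReductionAtPrime_two W₁ hmod httW₁ hm2 ht
  have hengineG := TwistRootNumberTwisted.rootNumber_quadraticTwist_eq_of_good_kronecker_anyTwo W₁ hmod httW₁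
    (fun r hr2 hadd ↦ absurd hadd (by
      have hr : r = ⟨2, Nat.prime_two⟩ := Subtype.ext hr2
      subst hr
      exact ((W₁.hasMultiplicativeReductionAtPrime_iff_hasMultiplicativeReductionAt_holds ⟨2, Nat.prime_two⟩).mp hm2).not_hasAdditiveReductionAt))
    has4 hassq hgood_as
  rw [hwW₁t] at hengine₂
  have h2N₁ : 2 ∣ N₁ := (W₁.dvd_conductorNorm_iff_not_hasGoodReductionAtPrime 2).mpr
    (fun hg ↦ ((W₁.hasMultiplicativeReductionAtPrime_iff_hasMultiplicativeReductionAt_holds ⟨2, Nat.prime_two⟩).mp hm2).not_hasGoodReductionAt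
      ((W₁.hasGoodReductionAtPrime_iff_hasGoodReductionAt_holds ⟨2, Nat.prime_two⟩).mp hg))
  have h2mem : 2 ∈ N₁.primeFactors := Nat.mem_primeFactors.mpr ⟨Nat.prime_two, h2N₁, hN₁0⟩
  have hfac2 : N₁.factorization 2 = 1 := by
    rw [hN₁, show N₁.factorization 2 = (W₁.conductorNorm ℤ).factorization (⟨2, Nat.prime_two⟩ : Nat.Primes) from rfl,
      factorization_conductorNorm_primesEquiv_symm W₁ ⟨2, Nat.prime_two⟩]
    exact (conductorExponent_eq_one_iff_holds _ W₁).mpr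
      ((W₁.hasMultiplicativeReductionAtPrime_iff_hasMultiplicativeReductionAt_holds ⟨2, Nat.prime_two⟩).mp hm2)
  set Pt : ℤ := ∏ r ∈ N₁.primeFactors.erase 2, (if N₁.factorization r = 1 then J(t | r) else 1) with hPt
  have hprodG : (∏ r ∈ N₁.primeFactors,
      (if N₁.factorization r = 1 then (if r = 2 then ZMod.χ₈ (as : ZMod 8) else J(as | r)) else 1)) = ZMod.χ₈ (as : ZMod 8) * Pt := by
    rw [← Finset.mul_prod_erase _ _ h2mem, if_pos hfac2, if_pos rfl, hPt]
    congr 1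
    refine Finset.prod_congr rfl fun r hr ↦ ?_
    obtain ⟨hr2, hrN₁⟩ := Finset.mem_erase.mp hr
    obtain ⟨hrp, hrdvd, -⟩ := Nat.mem_primeFactors.mp hrN₁
    rw [if_neg hr2]
    by_cases h1 : N₁.factorization r = 1
    · rw [if_pos h1, if_pos h1, hJbad r hrp ((hodd_dvd r hrp hr2).mp hrdvd) hr2]
    · rw [if_neg h1, if_neg h1]
  have hPtsq : Pt * Pt = 1 := by
    rw [hPt, ← Finset.prod_mul_distrib]
    refine Finset.prod_eq_one fun r hr ↦ ?_
    obtain ⟨hr2, hrN₁⟩ := Finset.mem_erase.mp hr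
    by_cases h1 : N₁.factorization r = 1
    · rw [if_pos h1]; exact hJtsq r (Nat.prime_of_mem_primeFactors hrN₁) hr2
    · rw [if_neg h1]; norm_num
  rw [hprodG] at hengineG
  set s₂ : ℤ := (if W₁.HasSplitMultiplicativeReductionAtPrime 2 then -1 else 1) with hs₂
  have hχ₈s₂ : ZMod.χ₈ (as : ZMod 8) * s₂ = 1 := by
    have has2 : as % 2 ≠ 0 := by omega
    rw [ZMod.χ₈_int_eq_if_mod_eight, if_neg has2, has8]
    by_cases h : W₁.HasSplitMultiplicativeReductionAtPrime 2 <;> simp [hc8, hs₂, h]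
  have hχ₄σ : ZMod.χ₄ (as.natAbs : ZMod 4) * σ = 1 := by
    rw [hasabs]
    have hodd : a % 2 = 1 := ha.eq_two_or_odd.resolve_left ha2
    by_cases h4 : a % 4 = 1
    · have he : Even (a / 2) := ⟨a / 4, by omega⟩
      have hσ1 : σ = 1 := by rw [← hσa, he.neg_one_pow]
      rw [ZMod.χ₄_nat_one_mod_four h4, hσ1]; norm_num
    · have h3 : a % 4 = 3 := by omega
      have ho : Odd (a / 2) := ⟨a / 4, by omega⟩
      have hσ1 : σ = -1 := by rw [← hσa, ho.neg_one_pow]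
      rw [ZMod.χ₄_nat_three_mod_four h3, hσ1]; norm_num
  have hwX₁ : (W₁.quadraticTwist (as : ℚ)).rootNumber = -1 := by
    rw [hengineG]
    have hσsq : σ * σ = 1 := by rcases hσ with h | h <;> rw [h] <;> norm_num
    have hs₂sq : s₂ * s₂ = 1 := by rw [hs₂]; split_ifs <;> norm_num
    have e1 : Pt * W₁.rootNumber = -(σ * s₂) := by
      have e := hengine₂
      linear_combination (-(σ * s₂)) * e - (Pt * W₁.rootNumber * (s₂ * s₂)) * hσsq - (Pt * W₁.rootNumber) * hs₂sq
    linear_combination (ZMod.χ₄ (as.natAbs : ZMod 4) * ZMod.χ₈ (as : ZMod 8)) * e1 -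
      (ZMod.χ₄ (as.natAbs : ZMod 4) * σ) * hχ₈s₂ - hχ₄σ
  -- §3 the auxiliary twist `X = E^{(4t·a*)} ≅ W₁^{(a*)}`: root number `−1`
  set D₀ : ℤ := 4 * t * as with hD₀
  have hD₀0 : D₀ ≠ 0 := by rw [hD₀]; exact mul_ne_zero (mul_ne_zero (by norm_num) ht0) has0
  have hD₀Q : (D₀ : ℚ) ≠ 0 := by exact_mod_cast hD₀0
  haveI := W.isElliptic_quadraticTwist hD₀Q
  have hasQ : (as : ℚ) ≠ 0 := by exact_mod_cast has0
  haveI := W₁.isElliptic_quadraticTwist hasQ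
  have hwX : (W.quadraticTwist (D₀ : ℚ)).rootNumber = -1 := by
    obtain ⟨C₂, hC₂⟩ := (W₁.quadraticTwist (as : ℚ)).exists_variableChange_smul_eq_quadraticTwist_sq (θ := (2 : ℚ)) two_ne_zero
    have heq : W.quadraticTwist (D₀ : ℚ) =
        ((⟨C₁.u, ((4 * as : ℤ) : ℚ) * C₁.r, 0, 0⟩ : VariableChange ℚ) * C₂) • W₁.quadraticTwist (as : ℚ) := by
      have e1 : (D₀ : ℚ) = (t : ℚ) * ((4 * as : ℤ) : ℚ) := by rw [hD₀]; push_cast; ring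
      rw [e1, ← quadraticTwist_quadraticTwist, ← hC₁, quadraticTwist_smul, mul_smul, hC₂, quadraticTwist_quadraticTwist]
      congr 2; push_cast; ring
    rw [heq, rootNumber_smul_holds]; exact hwX₁
  set M : ℕ := ∏ i ∈ N.primeFactors.erase 2, i with hM
  have hM0 : M ≠ 0 := Finset.prod_ne_zero_iff.mpr fun i hi ↦ (Nat.mem_primeFactors.mp (Finset.mem_erase.mp hi).2).1.ne_zero
  have hMdvd : ∀ r : ℕ, r.Prime → r ∣ N → r ≠ 2 → r ∣ M := fun r hr hrN hr2 ↦
    Finset.dvd_prod_of_mem (fun i ↦ i) (Finset.mem_erase.mpr ⟨hr2, Nat.mem_primeFactors.mpr ⟨hr, hrN, hN0⟩⟩)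
  have hMmem : ∀ r : ℕ, r.Prime → r ∣ M → r ∣ N ∧ r ≠ 2 := by
    intro r hr h
    obtain ⟨i, hi, hri⟩ := ((Nat.Prime.prime hr).dvd_finsetProd_iff (fun i ↦ i)).mp h
    obtain ⟨hi2, hiN⟩ := Finset.mem_erase.mp hi
    have hip := Nat.mem_primeFactors.mp hiN
    have hri' : r = i := (Nat.prime_dvd_prime_iff_eq hr hip.1).mp hri
    subst hri'
    exact ⟨hip.2.1, hi2⟩
  set N₂ : ℕ := 2 * p * a * M with hN₂
  have hN₂0 : N₂ ≠ 0 := by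
    rw [hN₂]; exact mul_ne_zero (mul_ne_zero (mul_ne_zero two_ne_zero hp.ne_zero) ha.ne_zero) hM0
  obtain ⟨K₁, iF₁, iN₁, hK₁, hB₁, -, hH₂, hL1⟩ := hFH (W.quadraticTwist (D₀ : ℚ)) hwX N₂ hN₂0 (B + 4)
  obtain ⟨d₁, hd₁neg, hfund₁, hBd₁, hkr₁, hL1₁⟩ :=
    (exists_heegnerField_iff_exists_fundamental N₂ (B + 4)
      (fun D ↦ ((W.quadraticTwist (D₀ : ℚ)).quadraticTwist (D : ℚ)).entireLFunction 1 ≠ 0)).mp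
      ⟨K₁, iF₁, iN₁, hK₁, hB₁, hH₂, hL1⟩
  have hd₁8 : d₁ % 8 = 1 := (hkr₁ 2 Nat.prime_two ⟨p * a * M, by rw [hN₂]; ring⟩).1 rfl
  have hsq₁ : Squarefree d₁ := by
    rcases hfund₁ with ⟨-, h, -⟩ | ⟨h4, -, -⟩
    · exact h
    · exfalso; omega
  have hda : jacobiSym d₁ a = 1 := (hkr₁ a ha ⟨2 * p * M, by rw [hN₂]; ring⟩).2 ha2
  have hdp : jacobiSym d₁ p = 1 := (hkr₁ p hp ⟨2 * a * M, by rw [hN₂]; ring⟩).2 hp2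
  have hdbad : ∀ r : ℕ, r.Prime → r ∣ N → r ≠ 2 → jacobiSym d₁ r = 1 := fun r hr hrN hr2 ↦
    (hkr₁ r hr ((hMdvd r hr hrN hr2).trans ⟨2 * p * a, by rw [hN₂]; ring⟩)).2 hr2
  -- §4 the discriminant `D = 4t·(a* d₁)`: even, negative, fundamental
  set n : ℤ := as * d₁ with hn
  set D : ℤ := 4 * t * n with hDdef
  have hDD₀ : D = D₀ * d₁ := by rw [hDdef, hD₀, hn]; ring
  have hn8 : n % 8 = c8 := by rw [hn, Int.mul_emod, has8, hd₁8]; rcases hc8' with h | h <;> rw [h] <;> decide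
  have hn2 : ¬ (2 : ℤ) ∣ n := by rcases hc8' with h | h <;> rw [h] at hn8 <;> omega
  have had₁ : ¬ (a : ℤ) ∣ d₁ := not_dvd_of_jacobiSym_eq_one₃ ha.one_lt hda
  have hnsq : Squarefree n := by
    rw [hn]
    refine Int.squarefree_natAbs.mp ?_
    rw [Int.natAbs_mul, hasabs]
    refine (Nat.squarefree_mul ((Nat.Prime.coprime_iff_not_dvd ha).mpr fun h ↦ had₁ (Int.natCast_dvd.mpr h))).mpr
      ⟨ha.prime.squarefree, Int.squarefree_natAbs.mpr hsq₁⟩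
  have hDneg : D < 0 := by
    have hσdef' : σ = if t = 2 then 1 else -1 := rfl
    rcases ht with rfl | rfl | rfl
    · have hσ1 : σ = -1 := by rw [hσdef']; decide
      have : D = 4 * a * d₁ := by rw [hDdef, hn, has_eq, hσ1]; ring
      rw [this]; exact mul_neg_of_pos_of_neg (mul_pos (by norm_num) (by exact_mod_cast ha.pos)) hd₁neg
    · have hσ1 : σ = 1 := by rw [hσdef']; decide
      have : D = 8 * a * d₁ := by rw [hDdef, hn, has_eq, hσ1]; ring
      rw [this]; exact mul_neg_of_pos_of_neg (mul_pos (by norm_num) (by exact_mod_cast ha.pos)) hd₁neg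
    · have hσ1 : σ = -1 := by rw [hσdef']; decide
      have : D = 8 * a * d₁ := by rw [hDdef, hn, has_eq, hσ1]; ring
      rw [this]; exact mul_neg_of_pos_of_neg (mul_pos (by norm_num) (by exact_mod_cast ha.pos)) hd₁neg
  have hfund : 4 ∣ D ∧ (D / 4 % 4 = 2 ∨ D / 4 % 4 = 3) ∧ Squarefree (D / 4) := by
    have hD4 : D / 4 = t * n := by rw [hDdef, mul_assoc, Int.mul_ediv_cancel_left _ (by norm_num)]
    refine ⟨⟨t * n, by rw [hDdef]; ring⟩, ?_, ?_⟩
    · rw [hD4]; rcases ht with rfl | rfl | rfl <;> omega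
    · rw [hD4]
      rcases ht with rfl | rfl | rfl
      · rw [neg_one_mul]; exact Int.squarefree_natAbs.mp (by rw [Int.natAbs_neg]; exact Int.squarefree_natAbs.mpr hnsq)
      · refine Int.squarefree_natAbs.mp ?_
        rw [Int.natAbs_mul]
        exact (Nat.squarefree_mul ((Nat.Prime.coprime_iff_not_dvd Nat.prime_two).mpr fun h ↦ hn2 (Int.natCast_dvd.mpr h))).mpr
          ⟨Nat.prime_two.prime.squarefree, Int.squarefree_natAbs.mpr hnsq⟩
      · refine Int.squarefree_natAbs.mp ?_
        rw [show (-2 : ℤ) * n = -(2 * n) by ring, Int.natAbs_neg, Int.natAbs_mul]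
        exact (Nat.squarefree_mul ((Nat.Prime.coprime_iff_not_dvd Nat.prime_two).mpr fun h ↦ hn2 (Int.natCast_dvd.mpr h))).mpr
          ⟨Nat.prime_two.prime.squarefree, Int.squarefree_natAbs.mpr hnsq⟩
  have hBD : B + 4 < D.natAbs := by
    have h1 : d₁.natAbs ≤ D.natAbs := by
      rw [hDD₀, Int.natAbs_mul]
      exact Nat.le_mul_of_pos_left _ (Int.natAbs_pos.mpr hD₀0)
    exact lt_of_lt_of_le hBd₁ h1
  set N₃ : ℕ := p * M with hN₃
  have hJ4 : ∀ r : ℕ, r.Prime → r ≠ 2 → J((4 : ℤ) | r) = 1 := by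
    intro r hr hr2
    rw [show (4 : ℤ) = 2 * 2 by norm_num, jacobiSym.mul_left]
    rcases jacobiSym.eq_one_or_neg_one (a := 2) (b := r) (by
      rw [Int.gcd_comm, Int.gcd_eq_natAbs]; simp only [Int.reduceAbs, Int.natAbs_natCast]
      exact (Nat.coprime_primes hr Nat.prime_two).mpr hr2) with h | h <;> rw [h] <;> norm_num
  have hkr : ∀ r : ℕ, r.Prime → r ∣ N₃ → (r = 2 → D % 8 = 1) ∧ (r ≠ 2 → jacobiSym D r = 1) := by
    intro r hr hrN₃
    have hr2 : r ≠ 2 := by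
      rintro rfl
      rcases (Nat.Prime.dvd_mul Nat.prime_two).mp hrN₃ with h | h
      · exact hp2 ((Nat.prime_dvd_prime_iff_eq Nat.prime_two hp).mp h).symm
      · exact (hMmem 2 Nat.prime_two h).2 rfl
    refine ⟨fun h ↦ absurd h hr2, fun _ ↦ ?_⟩
    have hj : J(t | r) * J(as | r) = 1 ∧ J(d₁ | r) = 1 := by
      rcases (Nat.Prime.dvd_mul hr).mp hrN₃ with hrp | hrM
      · have hrp' : r = p := (Nat.prime_dvd_prime_iff_eq hr hp).mp hrp
        subst hrp'
        exact ⟨by rw [hJp, hJtsq r hr hr2], hdp⟩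
      · obtain ⟨hrN, -⟩ := hMmem r hr hrM
        exact ⟨by rw [hJbad r hr hrN hr2, hJtsq r hr hr2], hdbad r hr hrN hr2⟩
    rw [hDdef, hn, show (4 : ℤ) * t * (as * d₁) = 4 * ((t * as) * d₁) by ring, jacobiSym.mul_left, jacobiSym.mul_left,
      jacobiSym.mul_left, hJ4 r hr hr2, hj.1, hj.2]
    norm_num
  -- `P(D)`: the genus class and `L(E^{(D)}, 1) = L(X^{(d₁)}, 1) ≠ 0`
  have hfun : (W.quadraticTwist (D : ℚ)).entireLFunction = ((W.quadraticTwist (D₀ : ℚ)).quadraticTwist (d₁ : ℚ)).entireLFunction := by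
    rw [quadraticTwist_quadraticTwist, hDD₀, Int.cast_mul]
  have hLD1 : (W.quadraticTwist (D : ℚ)).entireLFunction 1 ≠ 0 := by rw [hfun]; exact hL1₁
  have hclassD : ∃ m : ℤ, D = 4 * t * m ∧
      m % 8 = (if (W.quadraticTwist (t : ℚ)).HasSplitMultiplicativeReductionAtPrime 2 then 5 else 1) := by
    refine ⟨n, rfl, ?_⟩
    rw [hn8, hc8]
    by_cases h : W₁.HasSplitMultiplicativeReductionAtPrime 2
    · rw [if_pos h, if_pos (hsplit_iff.mp h)]
    · rw [if_neg h, if_neg (fun h' ↦ h (hsplit_iff.mpr h'))]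
  -- §5 the dictionary, backwards: the dyadic twisted road field `K`
  obtain ⟨K, iF, iN, hK, hB', hH, hclsK, hLK1⟩ :=
    (exists_heegnerField_iff_exists_fundamental N₃ (B + 4)
      (fun X ↦ (∃ m : ℤ, X = 4 * t * m ∧ m % 8 = (if (W.quadraticTwist (t : ℚ)).HasSplitMultiplicativeReductionAtPrime 2 then 5 else 1)) ∧
        (W.quadraticTwist (X : ℚ)).entireLFunction 1 ≠ 0)).mpr
      ⟨D, hDneg, Or.inr hfund, hBD, hkr, hclassD, hLD1⟩
  have hpN₃ : p ∣ N₃ := ⟨M, by rw [hN₃]⟩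
  have hdKabs : ((NumberField.discr K).natAbs : ℤ) = -NumberField.discr K := by
    rw [Int.natCast_natAbs, abs_of_neg hK.discr_neg]
  refine ⟨K, iF, iN, hK, by omega, hclsK, ?_, hH.of_dvd hpN₃, by omega, hLK1⟩
  intro r hr hrN hr2
  exact hH r hr ((hMdvd r hr hrN hr2).trans ⟨p, by rw [hN₃]; ring⟩)

end Summit.BirchSwinnertonDyer.BirchSwinnertonDyer.Theorems.TwistedWanRoad

end
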